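import Mathlib
import Summits.NavierStokesRegularity.NavierStokesRegularity.Theorems.HeteroclinicTriggerChainTriggerChainFrontStepSeededTruncation
import HarnessLib

/-!
# `HeteroclinicTriggerChain` — crux `TriggerChainFrontStep` (item stmt-NavierStokesRegularity-22785):
  window estimates for the DELAY PHASE of the hop in the seeded two-shell truncation

Scalar tools for the delay-phase analysis (blueprint item 2 of the lead prover's card
`Cruxes/TriggerChainFrontStep/Lines/gapdata_v2.md`) of the seeded two-shell truncation of the pinned table
`α₀ + βσ` — carrier `x`, trigger `u`, receiver `y`, upper trigger `v`:
`x′ = −eu² − βuv`, `u′ = exu − guy`, `y′ = gu² − e′v²`, `v′ = βxu + e′yv` (the system of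
`…TriggerChainFrontStepSeededTruncation`). All lemmas are stated for an ABSTRACT trigger rate `u′ = r·u` with a
one-sided bound on `r` over a window `[0, t]`, so that they can be re-used verbatim for the front shells of the
lattice; every proof is a monotonicity identity for an explicit integrating-factor combination (no ODE
uniqueness, no integrals beyond the factor `exp(−∫e′y)`):
* `htcTP_exp_growth_lower/upper`, `htcTP_mono_of_rate_nonneg` — `u(0)e^{as} ≤ u(s) ≤ u(0)e^{bs}` from
  `a ≤ r ≤ b`;
* `htcTP_upper_nonneg` — the upper trigger keeps its sign (`W = v·exp(−∫e′y)` is non-decreasing);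
* `htcTP_upper_bound` — CENTRE DRIFT of the upper trigger in Grönwall form,
  `v(s) ≤ e^{2e′δ₂ s}(v(0) + 2βu(s)/e)` from `r ≥ e/2`, `x ≤ 1`, `y ≤ 2δ₂`
  (`G = e·v·e^{−2e′δ₂ s} − 2βu` is non-increasing);
* `htcTP_receiver_window` — the receiver is non-decreasing and `y ≤ y(0) + g(u² − u(0)²)/e` while the pump
  dominates the drain (`H = e·y − g·u²` is non-increasing);
* `htcTP_carrier_window` — the carrier loses at most the pump work plus the seed work,
  `x ≥ x(0) − (u² − u(0)²) − 2βV(u − u(0))/e` (`P = e·x + e·u² + 2βV·u` is non-decreasing);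
* `htcTP_seed_window` — the seed collected, `v ≥ v(0) + β(1−δ₁)(u − u(0))/e` from `r ≤ e`, `x ≥ 1 − δ₁`
  (`R = e·v − β(1−δ₁)·u` is non-decreasing).

HONEST FRAMING: elementary real-analysis facts about scalar ODE combinations (MODEL truncation of Tao's
lattice, Tao 2016 §4); helper lemmas for the crux, no stub credit; nothing here is a statement about the
Navier–Stokes equations; no summit, rung or crux is proved. NS regularity is not proved by this line.
-/

noncomputable section

-- the sub-problem namespace `Summit.NavierStokesRegularity.NavierStokesRegularity` repeats the summit name by design (D-0017)
set_option linter.dupNamespace false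

open Real Set

namespace Summit.NavierStokesRegularity.NavierStokesRegularity.Theorems

/-! ### Monotonicity helpers on a window `[0, t]` -/

/-- If `F′ ≥ 0` on `[0, t]` then `F(0) ≤ F(s)` for `s ∈ [0, t]`. [folklore] -/
theorem htcTP_le_of_deriv_nonneg {F F' : ℝ → ℝ} {t : ℝ} (hF : ∀ s, HasDerivAt F (F' s) s)
    (hnn : ∀ s ∈ Icc 0 t, 0 ≤ F' s) : ∀ s ∈ Icc 0 t, F 0 ≤ F s := by
  intro s hs
  have hmono : MonotoneOn F (Icc 0 t) :=
    monotoneOn_of_deriv_nonneg (convex_Icc 0 t) (fun r _ => (hF r).continuousAt.continuousWithinAt)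
      (fun r _ => (hF r).differentiableAt.differentiableWithinAt) fun r hr => by
        rw [(hF r).deriv]
        exact hnn r (interior_subset hr)
  exact hmono (left_mem_Icc.2 (hs.1.trans hs.2)) hs hs.1

/-- If `F′ ≤ 0` on `[0, t]` then `F(s) ≤ F(0)` for `s ∈ [0, t]`. [folklore] -/
theorem htcTP_le_of_deriv_nonpos {F F' : ℝ → ℝ} {t : ℝ} (hF : ∀ s, HasDerivAt F (F' s) s)
    (hnp : ∀ s ∈ Icc 0 t, F' s ≤ 0) : ∀ s ∈ Icc 0 t, F s ≤ F 0 := by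
  intro s hs
  have h := htcTP_le_of_deriv_nonneg (F := fun r => -F r) (F' := fun r => -F' r)
    (fun r => (hF r).neg) (fun r hr => by simpa using hnp r hr) s hs
  simpa using h

/-- The derivative of `s ↦ exp(−a s)` is `exp(−a s) · (−a)`. [folklore] -/
theorem htcTP_hasDerivAt_exp_neg_mul (a s : ℝ) :
    HasDerivAt (fun r => Real.exp (-(a * r))) (Real.exp (-(a * s)) * (-a)) s := by
  have h := ((hasDerivAt_id s).const_mul a).neg
  simp only [id_eq, mul_one] at h
  exact h.exp

/-! ### Scalar comparison lemmas for `u′ = r·u` -/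

/-- **Exponential growth from below**: if `u′ = r u`, `u ≥ 0` and `r ≥ a` on `[0, t]`, then
`u(0) e^{a s} ≤ u(s)` on `[0, t]`. [folklore] -/
theorem htcTP_exp_growth_lower {u r : ℝ → ℝ} (hu' : ∀ s, HasDerivAt u (r s * u s) s)
    (hunn : ∀ s, 0 ≤ u s) {t a : ℝ} (hr : ∀ s ∈ Icc 0 t, a ≤ r s) :
    ∀ s ∈ Icc 0 t, u 0 * Real.exp (a * s) ≤ u s := by
  have hQ : ∀ s, HasDerivAt (fun q => u q * Real.exp (-(a * q)))
      (r s * u s * Real.exp (-(a * s)) + u s * (Real.exp (-(a * s)) * (-a))) s := fun s =>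
    (hu' s).mul (htcTP_hasDerivAt_exp_neg_mul a s)
  have hQ' : ∀ s ∈ Icc 0 t, 0 ≤ r s * u s * Real.exp (-(a * s)) + u s * (Real.exp (-(a * s)) * (-a)) := by
    intro s hs
    have h1 : r s * u s * Real.exp (-(a * s)) + u s * (Real.exp (-(a * s)) * (-a)) =
        (r s - a) * (u s * Real.exp (-(a * s))) := by ring
    rw [h1]
    exact mul_nonneg (by linarith [hr s hs]) (mul_nonneg (hunn s) (Real.exp_pos _).le)
  intro s hs
  have h1 := htcTP_le_of_deriv_nonneg hQ hQ' s hs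
  simp only [mul_zero, neg_zero, Real.exp_zero, mul_one] at h1
  have h2 : u s = u s * Real.exp (-(a * s)) * Real.exp (a * s) := by
    rw [mul_assoc, ← Real.exp_add, neg_add_cancel, Real.exp_zero, mul_one]
  rw [h2]
  exact mul_le_mul_of_nonneg_right h1 (Real.exp_pos _).le

/-- **Exponential growth from above**: if `u′ = r u`, `u ≥ 0` and `r ≤ b` on `[0, t]`, then
`u(s) ≤ u(0) e^{b s}` on `[0, t]`. [folklore] -/
theorem htcTP_exp_growth_upper {u r : ℝ → ℝ} (hu' : ∀ s, HasDerivAt u (r s * u s) s)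
    (hunn : ∀ s, 0 ≤ u s) {t b : ℝ} (hr : ∀ s ∈ Icc 0 t, r s ≤ b) :
    ∀ s ∈ Icc 0 t, u s ≤ u 0 * Real.exp (b * s) := by
  have hQ : ∀ s, HasDerivAt (fun q => u q * Real.exp (-(b * q)))
      (r s * u s * Real.exp (-(b * s)) + u s * (Real.exp (-(b * s)) * (-b))) s := fun s =>
    (hu' s).mul (htcTP_hasDerivAt_exp_neg_mul b s)
  have hQ' : ∀ s ∈ Icc 0 t, r s * u s * Real.exp (-(b * s)) + u s * (Real.exp (-(b * s)) * (-b)) ≤ 0 := by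
    intro s hs
    have h1 : r s * u s * Real.exp (-(b * s)) + u s * (Real.exp (-(b * s)) * (-b)) =
        -((b - r s) * (u s * Real.exp (-(b * s)))) := by ring
    rw [h1, neg_nonpos]
    exact mul_nonneg (by linarith [hr s hs]) (mul_nonneg (hunn s) (Real.exp_pos _).le)
  intro s hs
  have h1 := htcTP_le_of_deriv_nonpos hQ hQ' s hs
  simp only [mul_zero, neg_zero, Real.exp_zero, mul_one] at h1
  have h2 : u s = u s * Real.exp (-(b * s)) * Real.exp (b * s) := by
    rw [mul_assoc, ← Real.exp_add, neg_add_cancel, Real.exp_zero, mul_one]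
  rw [h2]
  exact mul_le_mul_of_nonneg_right h1 (Real.exp_pos _).le

/-- If `u′ = r u` with `r ≥ 0` on `[0, t]` and `u ≥ 0`, then `u(0) ≤ u(s)` on `[0, t]`. [folklore] -/
theorem htcTP_mono_of_rate_nonneg {u r : ℝ → ℝ} (hu' : ∀ s, HasDerivAt u (r s * u s) s)
    (hunn : ∀ s, 0 ≤ u s) {t : ℝ} (hr : ∀ s ∈ Icc 0 t, 0 ≤ r s) :
    ∀ s ∈ Icc 0 t, u 0 ≤ u s := by
  intro s hs
  have h := htcTP_exp_growth_lower hu' hunn (a := 0) (fun s hs => by simpa using hr s hs) s hs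
  simpa using h

/-! ### The four window estimates of the delay phase -/

/-- **Upper trigger keeps its sign**: if `v′ = βxu + e′yv` with `βxu ≥ 0` on `[0, t]` and `v(0) ≥ 0`,
then `v ≥ 0` on `[0, t]` (integrating factor `exp(−∫e′y)`). [folklore] -/
theorem htcTP_upper_nonneg {x u y v : ℝ → ℝ} {β e' : ℝ}
    (hv : ∀ s, HasDerivAt v (β * x s * u s + e' * y s * v s) s) (hyc : Continuous y)
    {t : ℝ} (hxu : ∀ s ∈ Icc 0 t, 0 ≤ β * x s * u s) (hv0 : 0 ≤ v 0) :
    ∀ s ∈ Icc 0 t, 0 ≤ v s := by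
  have hfc : Continuous fun s => e' * y s := continuous_const.mul hyc
  have hΦ := htcST_hasDerivAt_primitive hfc
  have hW : ∀ s, HasDerivAt (fun r => v r * Real.exp (-(∫ τ in (0 : ℝ)..r, e' * y τ)))
      (β * x s * u s * Real.exp (-(∫ τ in (0 : ℝ)..s, e' * y τ))) s := by
    intro s
    have h1 := (hv s).mul (hΦ s).neg.exp
    refine h1.congr_deriv ?_
    simp only [Pi.neg_apply]
    ring
  have hWle := htcTP_le_of_deriv_nonneg hW fun s hs =>
    mul_nonneg (hxu s hs) (Real.exp_pos _).le
  intro s hs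
  have h1 := hWle s hs
  simp only [intervalIntegral.integral_same, neg_zero, Real.exp_zero, mul_one] at h1
  have h2 : 0 < Real.exp (-(∫ τ in (0 : ℝ)..s, e' * y τ)) := Real.exp_pos _
  have h3 : 0 ≤ v s * Real.exp (-(∫ τ in (0 : ℝ)..s, e' * y τ)) := hv0.trans h1
  exact nonneg_of_mul_nonneg_left h3 h2  -- 0 ≤ v s * E with E > 0

/-- **Centre drift of the upper trigger (Grönwall form)**: if `v′ = βxu + e′yv`, `u′ = ru` with
`r ≥ e/2`, `x ≤ 1`, `u, v ≥ 0` and `y ≤ 2δ₂` on `[0, t]`, then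
`v(s) ≤ e^{2e′δ₂ s} (v(0) + 2βu(s)/e)` on `[0, t]`: the seed collected is at most `2βu/e` and it is
amplified at most at the rate `2e′δ₂` of the receiver residue. [folklore] -/
theorem htcTP_upper_bound {x u y v r : ℝ → ℝ} {β e e' δ₂ : ℝ} (he : 0 < e) (hβ : 0 ≤ β)
    (he' : 0 ≤ e') (hδ₂ : 0 ≤ δ₂)
    (hv : ∀ s, HasDerivAt v (β * x s * u s + e' * y s * v s) s)
    (hu' : ∀ s, HasDerivAt u (r s * u s) s) (hx1 : ∀ s, x s ≤ 1) (hunn : ∀ s, 0 ≤ u s)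
    {t : ℝ} (hr : ∀ s ∈ Icc 0 t, e / 2 ≤ r s) (hvnn : ∀ s ∈ Icc 0 t, 0 ≤ v s)
    (hy2 : ∀ s ∈ Icc 0 t, y s ≤ 2 * δ₂) :
    ∀ s ∈ Icc 0 t, v s ≤ Real.exp (2 * e' * δ₂ * s) * (v 0 + 2 * β * u s / e) := by
  -- G = e · v · exp(−c s) − 2β u is non-increasing, c = 2e′δ₂
  have hG : ∀ s, HasDerivAt (fun q => e * (v q * Real.exp (-(2 * e' * δ₂ * q))) - 2 * β * u q)
      (e * ((β * x s * u s + e' * y s * v s) * Real.exp (-(2 * e' * δ₂ * s)) +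
        v s * (Real.exp (-(2 * e' * δ₂ * s)) * (-(2 * e' * δ₂)))) - 2 * β * (r s * u s)) s :=
    fun s => (((hv s).mul (htcTP_hasDerivAt_exp_neg_mul _ s)).const_mul e).sub ((hu' s).const_mul _)
  have hG' : ∀ s ∈ Icc 0 t, e * ((β * x s * u s + e' * y s * v s) * Real.exp (-(2 * e' * δ₂ * s)) +
        v s * (Real.exp (-(2 * e' * δ₂ * s)) * (-(2 * e' * δ₂)))) - 2 * β * (r s * u s) ≤ 0 := by
    intro s hs
    set E : ℝ := Real.exp (-(2 * e' * δ₂ * s)) with hE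
    have hE1 : E ≤ 1 := by
      rw [hE, Real.exp_le_one_iff, neg_nonpos]
      have := hs.1
      positivity
    have hE0 : 0 ≤ E := (Real.exp_pos _).le
    have hus := hunn s
    have hvs := hvnn s hs
    -- the three pieces
    have t1 : β * x s * u s * E ≤ β * u s := by
      have h1 : β * x s * u s ≤ β * u s := by
        have h2 := mul_le_mul_of_nonneg_left (hx1 s) (mul_nonneg hβ hus)
        calc β * x s * u s = β * u s * x s := by ring
          _ ≤ β * u s * 1 := h2
          _ = β * u s := by ring
      calc β * x s * u s * E ≤ β * u s * E := mul_le_mul_of_nonneg_right h1 hE0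
        _ ≤ β * u s * 1 := mul_le_mul_of_nonneg_left hE1 (mul_nonneg hβ hus)
        _ = β * u s := by ring
    have t2 : (e' * y s * v s + v s * (-(2 * e' * δ₂))) * E ≤ 0 := by
      have h1 : e' * y s * v s + v s * (-(2 * e' * δ₂)) = -(e' * v s * (2 * δ₂ - y s)) := by ring
      rw [h1]
      have h2 : 0 ≤ e' * v s * (2 * δ₂ - y s) :=
        mul_nonneg (mul_nonneg he' hvs) (by linarith [hy2 s hs])
      exact mul_nonpos_iff.2 (Or.inr ⟨by linarith, hE0⟩)
    have t3 : e * (β * u s) ≤ 2 * β * (r s * u s) := by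
      have h1 : 2 * β * (r s * u s) - e * (β * u s) = 2 * (β * u s) * (r s - e / 2) := by ring
      have h2 : 0 ≤ 2 * (β * u s) * (r s - e / 2) :=
        mul_nonneg (mul_nonneg (by norm_num) (mul_nonneg hβ hus)) (by linarith [hr s hs])
      linarith
    have h4 : e * ((β * x s * u s + e' * y s * v s) * E + v s * (E * (-(2 * e' * δ₂)))) =
        e * (β * x s * u s * E) + e * ((e' * y s * v s + v s * (-(2 * e' * δ₂))) * E) := by ring
    rw [h4]
    have h5 : e * (β * x s * u s * E) ≤ e * (β * u s) := mul_le_mul_of_nonneg_left t1 he.le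
    have h6 : e * ((e' * y s * v s + v s * (-(2 * e' * δ₂))) * E) ≤ 0 :=
      mul_nonpos_iff.2 (Or.inl ⟨he.le, t2⟩)
    linarith
  have hGle := htcTP_le_of_deriv_nonpos hG hG'
  intro s hs
  have h1 := hGle s hs
  simp only [mul_zero, neg_zero, Real.exp_zero, mul_one] at h1
  -- e · v s · exp(−cs) ≤ e v0 − 2β u0 + 2β u s ≤ e v0 + 2 β u s
  have h2 : e * (v s * Real.exp (-(2 * e' * δ₂ * s))) ≤ e * (v 0 + 2 * β * u s / e) := by
    have h3 : e * (v 0 + 2 * β * u s / e) = e * v 0 + 2 * β * u s := by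
      field_simp
    have h4 : 0 ≤ 2 * β * u 0 := by have := hunn 0; positivity
    linarith
  have h5 : v s * Real.exp (-(2 * e' * δ₂ * s)) ≤ v 0 + 2 * β * u s / e :=
    le_of_mul_le_mul_left h2 he
  have h6 : v s = v s * Real.exp (-(2 * e' * δ₂ * s)) * Real.exp (2 * e' * δ₂ * s) := by
    rw [mul_assoc, ← Real.exp_add, neg_add_cancel, Real.exp_zero, mul_one]
  rw [h6, mul_comm (Real.exp _)]
  exact mul_le_mul_of_nonneg_right h5 (Real.exp_pos _).le

/-- **Receiver drift**: if `y′ = gu² − e′v²`, `u′ = ru` with `r ≥ e/2` on `[0, t]`, and the upper drain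
is dominated by the pump, `e′v² ≤ gu²` on `[0, t]`, then on `[0, t]` the receiver is non-decreasing,
`y(0) ≤ y(s)`, and `y(s) ≤ y(0) + g (u(s)² − u(0)²)/e`. [folklore] -/
theorem htcTP_receiver_window {u y v r : ℝ → ℝ} {g e e' : ℝ} (he : 0 < e) (hg : 0 ≤ g) (he' : 0 ≤ e')
    (hy : ∀ s, HasDerivAt y (g * u s ^ 2 - e' * v s ^ 2) s)
    (hu' : ∀ s, HasDerivAt u (r s * u s) s)
    {t : ℝ} (hr : ∀ s ∈ Icc 0 t, e / 2 ≤ r s) (hdrain : ∀ s ∈ Icc 0 t, e' * v s ^ 2 ≤ g * u s ^ 2) :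
    ∀ s ∈ Icc 0 t, y 0 ≤ y s ∧ y s ≤ y 0 + g * (u s ^ 2 - u 0 ^ 2) / e := by
  have hylb := htcTP_le_of_deriv_nonneg hy fun s hs => by linarith [hdrain s hs]
  -- H = e y − g u² is non-increasing
  have hu2 : ∀ s, HasDerivAt (fun q => u q ^ 2) (2 * u s * (r s * u s)) s := by
    intro s
    have h1 := (hu' s).mul (hu' s)
    have h2 : (fun q => u q ^ 2) = fun q => u q * u q := funext fun q => sq (u q)
    rw [h2]
    exact h1.congr_deriv (by ring)
  have hH : ∀ s, HasDerivAt (fun q => e * y q - g * u q ^ 2)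
      (e * (g * u s ^ 2 - e' * v s ^ 2) - g * (2 * u s * (r s * u s))) s :=
    fun s => ((hy s).const_mul e).sub ((hu2 s).const_mul g)
  have hH' : ∀ s ∈ Icc 0 t, e * (g * u s ^ 2 - e' * v s ^ 2) - g * (2 * u s * (r s * u s)) ≤ 0 := by
    intro s hs
    have h1 : e * (g * u s ^ 2 - e' * v s ^ 2) - g * (2 * u s * (r s * u s)) =
        -(2 * g * u s ^ 2 * (r s - e / 2)) - e * (e' * v s ^ 2) := by ring
    rw [h1]
    have h2 : 0 ≤ 2 * g * u s ^ 2 * (r s - e / 2) :=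
      mul_nonneg (by positivity) (by linarith [hr s hs])
    have h3 : 0 ≤ e * (e' * v s ^ 2) := by positivity
    linarith
  have hHle := htcTP_le_of_deriv_nonpos hH hH'
  intro s hs
  refine ⟨hylb s hs, ?_⟩
  have h1 := hHle s hs
  have h2 : y 0 + g * (u s ^ 2 - u 0 ^ 2) / e = (e * y 0 + g * (u s ^ 2 - u 0 ^ 2)) / e := by
    field_simp
  rw [h2, le_div_iff₀ he]
  linarith

/-- **Carrier drift**: if `x′ = −eu² − βuv`, `u′ = ru` with `r ≥ e/2` on `[0, t]`, `u ≥ 0`, and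
`0 ≤ v ≤ V` on `[0, t]`, then `x(s) ≥ x(0) − (u(s)² − u(0)²) − 2βV(u(s) − u(0))/e` on `[0, t]`
(the carrier loses at most the pump work plus the seed work). [folklore] -/
theorem htcTP_carrier_window {x u v r : ℝ → ℝ} {e β V : ℝ} (he : 0 < e) (hβ : 0 ≤ β) (hV : 0 ≤ V)
    (hx : ∀ s, HasDerivAt x (-(e * u s ^ 2) - β * u s * v s) s)
    (hu' : ∀ s, HasDerivAt u (r s * u s) s) (hunn : ∀ s, 0 ≤ u s)
    {t : ℝ} (hr : ∀ s ∈ Icc 0 t, e / 2 ≤ r s) (hvV : ∀ s ∈ Icc 0 t, v s ≤ V) :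
    ∀ s ∈ Icc 0 t, x 0 - (u s ^ 2 - u 0 ^ 2) - 2 * β * V * (u s - u 0) / e ≤ x s := by
  have hu2 : ∀ s, HasDerivAt (fun q => u q ^ 2) (2 * u s * (r s * u s)) s := by
    intro s
    have h1 := (hu' s).mul (hu' s)
    have h2 : (fun q => u q ^ 2) = fun q => u q * u q := funext fun q => sq (u q)
    rw [h2]
    exact h1.congr_deriv (by ring)
  -- P = e x + e u² + 2βV u is non-decreasing
  have hP : ∀ s, HasDerivAt (fun q => e * x q + e * u q ^ 2 + 2 * β * V * u q)
      (e * (-(e * u s ^ 2) - β * u s * v s) + e * (2 * u s * (r s * u s)) + 2 * β * V * (r s * u s)) s :=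
    fun s => (((hx s).const_mul e).add ((hu2 s).const_mul e)).add ((hu' s).const_mul _)
  have hP' : ∀ s ∈ Icc 0 t,
      0 ≤ e * (-(e * u s ^ 2) - β * u s * v s) + e * (2 * u s * (r s * u s)) + 2 * β * V * (r s * u s) := by
    intro s hs
    have hus := hunn s
    have hrs : 0 ≤ r s - e / 2 := by linarith [hr s hs]
    have h1 : e * (-(e * u s ^ 2) - β * u s * v s) + e * (2 * u s * (r s * u s)) + 2 * β * V * (r s * u s) =
        2 * e * u s ^ 2 * (r s - e / 2) + 2 * β * V * u s * (r s - e / 2) + e * β * u s * (V - v s) := by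
      ring
    rw [h1]
    have h2 : 0 ≤ V - v s := by linarith [hvV s hs]
    positivity
  have hPle := htcTP_le_of_deriv_nonneg hP hP'
  intro s hs
  have h1 := hPle s hs
  have h2 : x 0 - (u s ^ 2 - u 0 ^ 2) - 2 * β * V * (u s - u 0) / e =
      (e * x 0 - e * (u s ^ 2 - u 0 ^ 2) - 2 * β * V * (u s - u 0)) / e := by
    field_simp
  rw [h2, div_le_iff₀ he]
  linarith

/-- **Seed collected during the delay phase**: if `v′ = βxu + e′yv`, `u′ = ru` with `r ≤ e`,
`x ≥ 1 − δ₁ ≥ 0`, `u ≥ 0` and `y, v ≥ 0` on `[0, t]`, then `v(s) ≥ v(0) + β(1−δ₁)(u(s) − u(0))/e` on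
`[0, t]`. [folklore] -/
theorem htcTP_seed_window {x u y v r : ℝ → ℝ} {β e e' δ₁ : ℝ} (he : 0 < e) (hβ : 0 ≤ β)
    (he' : 0 ≤ e') (hδ₁ : δ₁ ≤ 1)
    (hv : ∀ s, HasDerivAt v (β * x s * u s + e' * y s * v s) s)
    (hu' : ∀ s, HasDerivAt u (r s * u s) s) (hunn : ∀ s, 0 ≤ u s)
    {t : ℝ} (hr : ∀ s ∈ Icc 0 t, r s ≤ e) (hx : ∀ s ∈ Icc 0 t, 1 - δ₁ ≤ x s)
    (hynn : ∀ s ∈ Icc 0 t, 0 ≤ y s) (hvnn : ∀ s ∈ Icc 0 t, 0 ≤ v s) :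
    ∀ s ∈ Icc 0 t, v 0 + β * (1 - δ₁) * (u s - u 0) / e ≤ v s := by
  -- R = e v − β(1−δ₁) u is non-decreasing
  have hR : ∀ s, HasDerivAt (fun q => e * v q - β * (1 - δ₁) * u q)
      (e * (β * x s * u s + e' * y s * v s) - β * (1 - δ₁) * (r s * u s)) s :=
    fun s => ((hv s).const_mul e).sub ((hu' s).const_mul _)
  have hR' : ∀ s ∈ Icc 0 t, 0 ≤ e * (β * x s * u s + e' * y s * v s) - β * (1 - δ₁) * (r s * u s) := by
    intro s hs
    have hus := hunn s
    have hys := hynn s hs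
    have hvs := hvnn s hs
    have h0 : 0 ≤ 1 - δ₁ := by linarith
    have h1 : e * (β * x s * u s + e' * y s * v s) - β * (1 - δ₁) * (r s * u s) =
        e * β * u s * (x s - (1 - δ₁)) + β * (1 - δ₁) * u s * (e - r s) + e * (e' * y s * v s) := by ring
    rw [h1]
    have h2 : 0 ≤ x s - (1 - δ₁) := by linarith [hx s hs]
    have h3 : 0 ≤ e - r s := by linarith [hr s hs]
    positivity
  have hRle := htcTP_le_of_deriv_nonneg hR hR'
  intro s hs
  have h1 := hRle s hs
  have h2 : v 0 + β * (1 - δ₁) * (u s - u 0) / e = (e * v 0 + β * (1 - δ₁) * (u s - u 0)) / e := by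
    field_simp
  rw [h2, div_le_iff₀ he]
  linarith

end Summit.NavierStokesRegularity.NavierStokesRegularity.Theorems

end
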